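import Summits.AtomisticToContinuum.FouriersLaw.Theorems.OddSectorIrreversibilityCorrectorTheoryUniformH2
import Summits.AtomisticToContinuum.FouriersLaw.Theorems.OddSectorIrreversibilityCorrectorTheoryUniformMinorization
import Summits.AtomisticToContinuum.FouriersLaw.Theorems.OddSectorIrreversibilityCorrectorTheoryUniformReach
import Summits.AtomisticToContinuum.FouriersLaw.Theorems.OddSectorIrreversibilityResponseDensityUniformMixingReduction
import Summits.AtomisticToContinuum.FouriersLaw.Theorems.HonestZwanzigOpenChainGreenKubo
import Summits.AtomisticToContinuum.FouriersLaw.Theorems.OddSectorIrreversibilityCorrectorTheory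
import Literature.MathematicalPhysics.KineticTheory.LangevinSemigroupProofs
import Literature.MathematicalPhysics.KineticTheory.LangevinChainHarris

/-!
# `CorrectorTheory` (stmt-AtomisticToContinuum-14071): the uniform-in-`δ` exponential convergence, and the close

Closing file of item stmt-AtomisticToContinuum-14071 (`CorrectorTheory`, route `OddSectorIrreversibility`,
sub-problem `FouriersLaw` of `AtomisticToContinuum`). Conjunct A of the item is `Corrector.correctorCalculus`
(`…CorrectorTheory.lean`); conjunct B (the Kundu–Dhar–Narayan open-chain Green–Kubo identity) was reduced in
the tree to ONE dynamical input: the exponential convergence (2.5) of Cuneo–Eckmann–Hairer–Rey-Bellet 2018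
for the kernels with baths at `T ± δ/2`, with constants UNIFORM in `|δ| < δ₀`
(`OpenChainGreenKubo.openChainGreenKubo_of_uniformDecay`, `Corrector.CorrectorTheory_of_openChainGreenKubo`,
`pinnedChain_uniformMixing_of_uniformDriftMinor`). This file supplies it:

* `pinnedChain_uniformMixing` — for the pinned chain (`ω₂, β, γ > 0`, `lam ≥ 0`, `N ≥ 1`) and every `T > 0`
  there are `δ₀, ϑ, C_m, c` with (2.5) for all kernels with baths at `T ± δ/2`, `|δ| < δ₀`, all their
  invariant probability measures, all continuous `|f| ≤ e^{ϑH}`. Proof: the uniform drift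
  (`pinnedChain_drift_uniform`, `…UniformH2.lean`) at time `1`, iterated to an integer time `n`; the
  uniform local minorisation at time one (`pinnedChain_minorization_at_one_uniform`, `…UniformMinorization.lean`)
  composed by Chapman–Kolmogorov with the uniform reachability of the equilibrium ball from the sublevel set
  `{e^{ϑH} ≤ R}` at time `n - 1` (`pinnedChain_reach_uniform`, `…UniformReach.lean`); and the uniform Harris
  theorem of `…ResponseDensityHarrisUniform.lean` through `pinnedChain_uniformMixing_of_uniformDriftMinor`.
* `uniformDecay_totalCurrent` — the hypothesis (UH) of `openChainGreenKubo_of_uniformDecay`;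
* `openChainGreenKubo_holds` — **`HonestZwanzig.OpenChainGreenKubo` holds** (item 12696's decl);
* `responseDensity_holds` — **`OddSectorIrreversibility.ResponseDensity` holds** (item 9144's decl);
* `CorrectorTheory_proof` — **the route decl `OddSectorIrreversibility.CorrectorTheory`, PROVED.**

No definitions, no named facts.
-/

noncomputable section

open MeasureTheory ProbabilityTheory Filter Topology Set Metric
open scoped NNReal ENNReal

namespace Summit.AtomisticToContinuum.FouriersLaw.Theorems.OddSectorIrreversibility.Corrector

open Literature.MathematicalPhysics.KineticTheory.HeatConduction
open Literature.Probability.Process OscillatorChain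
open Literature.MathematicalPhysics.KineticTheory

variable {N : ℕ}

/-- `|√u - 1| ≤ |u - 1|` for `u ≥ 0`. [folklore] -/
theorem abs_sqrt_sub_one_le {u : ℝ} (hu : 0 ≤ u) : |Real.sqrt u - 1| ≤ |u - 1| := by
  have hs := Real.sqrt_nonneg u
  have hmul : (Real.sqrt u - 1) * (Real.sqrt u + 1) = u - 1 := by nlinarith [Real.mul_self_sqrt hu]
  calc |Real.sqrt u - 1| = |Real.sqrt u - 1| * 1 := (mul_one _).symm
    _ ≤ |Real.sqrt u - 1| * (Real.sqrt u + 1) := mul_le_mul_of_nonneg_left (by linarith) (abs_nonneg _)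
    _ = |(Real.sqrt u - 1) * (Real.sqrt u + 1)| := by rw [abs_mul, abs_of_pos (by linarith : 0 < Real.sqrt u + 1)]
    _ = |u - 1| := by rw [hmul]

/-- The noise-amplitude ratio is controlled by the temperature ratio:
`|√(2γT')/√(2γT) - 1| ≤ |T'/T - 1|` (`γ, T > 0`, `T' ≥ 0`). [folklore] -/
theorem abs_amp_ratio_sub_one_le {γ T T' : ℝ} (hγ : 0 < γ) (hT : 0 < T) (hT' : 0 ≤ T') :
    |Real.sqrt (2 * γ * T') / Real.sqrt (2 * γ * T) - 1| ≤ |T' / T - 1| := by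
  rw [← Real.sqrt_div (by positivity : 0 ≤ 2 * γ * T')]
  have e : 2 * γ * T' / (2 * γ * T) = T' / T := by field_simp
  rw [e]
  exact abs_sqrt_sub_one_le (div_nonneg hT' hT.le)

section UM

variable {ω₂ lam β γ : ℝ} (hω : 0 < ω₂) (hl : 0 ≤ lam) (hβ : 0 < β) (hγ : 0 < γ) (hN : 0 < N)
  {T : ℝ} (hT : 0 < T)
include hω hl hβ hγ hN hT

set_option maxHeartbeats 1600000 in
/-- **CEHR (2.5) for baths at `T ± δ/2`, with constants uniform in `|δ| < δ₀`** (the hypothesis `hUM`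
of `responseDensity_of_uniformMixing`, the input UH of `openChainGreenKubo_of_uniformDecay`). For the
pinned chain (`ω₂, β, γ > 0`, `lam ≥ 0`, `N ≥ 1`) and `T > 0` there are `δ₀ ∈ (0, 2T)`,
`ϑ ∈ (0, 1/(T+δ₀/2))` with `2ϑ < 1/T`, `C_m ≥ 0`, `c > 0` such that for every `|δ| < δ₀`, every
invariant probability measure `ν` of the kernels `P^δ_t` with baths at `(T+δ/2, T-δ/2)`, every `z`,
`t ≥ 0` and every continuous `f` with `|f| ≤ e^{ϑH}`:
`|P^δ_t f(z) - ν(f)| ≤ C_m e^{ϑH(z)} e^{-ct}`.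
[cite: CuneoEckmannHairerReyBellet2018, Thm 2.13 (3) (proof, with uniform constants)]
[cite: HairerMattingly2011, Thm 1.2] -/
theorem pinnedChain_uniformMixing :
    ∃ (δ₀ ϑ Cm c : ℝ), 0 < δ₀ ∧ δ₀ < 2 * T ∧ 0 < ϑ ∧ ϑ < 1 / (T + δ₀ / 2) ∧ 2 * ϑ < 1 / T ∧
      0 ≤ Cm ∧ 0 < c ∧
      (∀ δ : ℝ, |δ| < δ₀ → ∀ ν : Measure (PhaseSpace N), IsProbabilityMeasure ν →
        (∀ t : ℝ≥0, ν.bind ((pinnedChain ω₂ lam β γ).transitionKernel N (T + δ / 2) (T - δ / 2) t) = ν) →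
        ∀ (z : PhaseSpace N) (t : ℝ≥0) (f : PhaseSpace N → ℝ), Continuous f →
          (∀ y, |f y| ≤ Real.exp (ϑ * (pinnedChain ω₂ lam β γ).hamiltonian N y)) →
          |(∫ y, f y ∂((pinnedChain ω₂ lam β γ).transitionKernel N (T + δ / 2) (T - δ / 2) t z)) -
              ∫ y, f y ∂ν| ≤
            Cm * Real.exp (ϑ * (pinnedChain ω₂ lam β γ).hamiltonian N z) * Real.exp (-c * t)) := by
  have hT0 : T ≠ 0 := hT.ne'
  set Pc := pinnedChain ω₂ lam β γ with hPc
  set Hm := Pc.hamiltonian N with hHm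
  -- the local minorisation at the reference temperatures `(T, T)`
  obtain ⟨ε₁, hε₁, r, hr, cmin, hcmin, hmin1⟩ := pinnedChain_minorization_at_one_uniform hω hl hβ hγ hN hT hT
  -- the width `δ₀`
  set δ₀ : ℝ := min T (T * ε₁) with hδ₀
  have hδ₀pos : 0 < δ₀ := lt_min hT (by positivity)
  have hδ₀T : δ₀ ≤ T := min_le_left _ _
  have hδ₀ε : δ₀ ≤ T * ε₁ := min_le_right _ _
  have hδ₀2T : δ₀ < 2 * T := by linarith
  set Tmax : ℝ := T + δ₀ / 2 with hTmax
  have hTmax0 : 0 < Tmax := by positivity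
  -- the exponent `ϑ = 1/(4T)`
  set ϑ : ℝ := 1 / (4 * T) with hϑ
  have hϑ0 : 0 < ϑ := by positivity
  have hϑT : ϑ < 1 / Tmax := by
    rw [hϑ]; exact one_div_lt_one_div_of_lt hTmax0 (by linarith)
  have h2ϑ : 2 * ϑ < 1 / T := by
    have e : 2 * ϑ = 1 / (2 * T) := by rw [hϑ]; ring
    rw [e]; exact one_div_lt_one_div_of_lt hT (by linarith)
  -- bath facts for `|δ| < δ₀`
  have hbath : ∀ δ : ℝ, |δ| < δ₀ → 0 < T + δ / 2 ∧ 0 < T - δ / 2 ∧ T + δ / 2 ≤ Tmax ∧ T - δ / 2 ≤ Tmax ∧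
      |Real.sqrt (2 * γ * (T + δ / 2)) / Real.sqrt (2 * γ * T) - 1| < ε₁ ∧
      |Real.sqrt (2 * γ * (T - δ / 2)) / Real.sqrt (2 * γ * T) - 1| < ε₁ := by
    intro δ hδ
    have h1 := abs_lt.1 hδ
    have hL : 0 < T + δ / 2 := by linarith
    have hR : 0 < T - δ / 2 := by linarith
    have hratio : |δ| / (2 * T) < ε₁ := by
      rw [div_lt_iff₀ (by positivity)]
      nlinarith [mul_pos hT hε₁]
    refine ⟨hL, hR, by rw [hTmax]; linarith, by rw [hTmax]; linarith, ?_, ?_⟩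
    · refine (abs_amp_ratio_sub_one_le hγ hT hL.le).trans_lt ?_
      have e : (T + δ / 2) / T - 1 = δ / (2 * T) := by field_simp; ring
      rw [e, abs_div, abs_of_pos (by positivity : (0 : ℝ) < 2 * T)]
      exact hratio
    · refine (abs_amp_ratio_sub_one_le hγ hT hR.le).trans_lt ?_
      have e : (T - δ / 2) / T - 1 = -(δ / (2 * T)) := by field_simp; ring
      rw [e, abs_neg, abs_div, abs_of_pos (by positivity : (0 : ℝ) < 2 * T)]
      exact hratio
  -- the family of kernels and its algebra
  set κ : ℝ → ℝ≥0 → Kernel (PhaseSpace N) (PhaseSpace N) :=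
    fun δ t => Pc.transitionKernel N (T + δ / 2) (T - δ / 2) t with hκ
  haveI : ∀ (δ : ℝ) (t : ℝ≥0), IsMarkovKernel (κ δ t) := fun δ t =>
    pinnedChain_isMarkovKernel_transitionKernel hω hl hβ.le hγ.le N _ _ t
  have h_add : ∀ (δ : ℝ) (s t : ℝ≥0), κ δ (s + t) = κ δ t ∘ₖ κ δ s := fun δ s t =>
    pinnedChain_transitionKernel_add hω hl hβ.le hγ.le N _ _ s t
  have h_pow : ∀ δ : ℝ, |δ| < δ₀ → ∀ n : ℕ, κ δ (n : ℝ≥0) = κ δ 1 ^ n := by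
    intro δ hδ n
    obtain ⟨hL, hR, -⟩ := hbath δ hδ
    have h := (pinnedChainSemigroup hω hl hβ.le hγ.le hN hL.le hR.le).kernel_nat_mul 1 n
    rw [mul_one] at h
    simpa only [pinnedChainSemigroup_kernel] using h
  -- the Lyapunov function `V = e^{ϑH}`
  have hHc : Continuous Hm := pinnedChain_continuous_hamiltonian ω₂ lam β γ N
  set V : PhaseSpace N → ℝ≥0 := fun z => (Real.exp (ϑ * Hm z)).toNNReal with hVdef
  have hV : Measurable V := (continuous_real_toNNReal.comp (Real.continuous_exp.comp
    (continuous_const.mul hHc))).measurable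
  have hVcoe : ∀ z, (V z : ℝ≥0∞) = ENNReal.ofReal (Real.exp (ϑ * Hm z)) := fun z => rfl
  have hVreal : ∀ z, (V z : ℝ) = Real.exp (ϑ * Hm z) := fun z => Real.coe_toNNReal _ (Real.exp_pos _).le
  -- UDRIFT at time `1`
  obtain ⟨cd, hcd, hdrift1⟩ := pinnedChain_drift_uniform hω hl hβ hγ hN hTmax0 hϑ0 hϑT 1 one_pos
  set a : ℝ≥0 := (1 / 2 : ℝ).toNNReal with ha
  set b₀ : ℝ≥0 := cd.toNNReal with hb₀
  have ha1 : a < 1 := by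
    rw [← NNReal.coe_lt_coe, ha, Real.coe_toNNReal _ (by norm_num), NNReal.coe_one]; norm_num
  have hdriftV : ∀ δ : ℝ, |δ| < δ₀ → ∀ z, ∫⁻ y, (V y : ℝ≥0∞) ∂(κ δ 1 z) ≤ (a : ℝ≥0∞) * V z + b₀ := by
    intro δ hδ z
    obtain ⟨hL, hR, hLm, hRm, -⟩ := hbath δ hδ
    simp only [hVcoe]
    refine (hdrift1 _ _ hL hR hLm hRm z).trans ?_
    rw [ENNReal.ofReal_add (by positivity) hcd.le, ENNReal.ofReal_mul (by norm_num)]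
    exact le_of_eq rfl
  -- the skeleton drift at integer times: `γₙ = aⁿ`, `K = B = b₀/(1-a)`
  set B : ℝ≥0 := b₀ / (1 - a) with hB
  have h1a : 0 < 1 - a := tsub_pos_of_lt ha1
  set R : ℝ≥0 := (2 * B + 1) / (1 - a) with hRdef
  have hRa : (1 - a) * R = 2 * B + 1 := by rw [hRdef, mul_comm, div_mul_cancel₀ _ h1a.ne']
  have hR1' : (1 : ℝ≥0) ≤ R := by
    rw [hRdef, le_div_iff₀ h1a, one_mul]
    exact tsub_le_self.trans le_add_self
  have hR1 : (1 : ℝ) ≤ R := by exact_mod_cast hR1'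
  have hdriftn : ∀ δ : ℝ, |δ| < δ₀ → ∀ (n : ℕ) z,
      ∫⁻ y, (V y : ℝ≥0∞) ∂(κ δ (n : ℝ≥0) z) ≤ ((a ^ n : ℝ≥0) : ℝ≥0∞) * V z + B := by
    intro δ hδ n z
    rw [h_pow δ hδ n, ENNReal.coe_pow]
    exact Harris.lintegral_pow_le_of_drift (κ δ 1) hV ha1 (hdriftV δ hδ) n z
  -- the energy level of the sublevel set `{V ≤ R}`
  set E : ℝ := Real.log R / ϑ with hE
  have hVE : ∀ x : PhaseSpace N, Real.exp (ϑ * Hm x) ≤ R → Hm x ≤ E := by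
    intro x hx
    rw [hE, le_div_iff₀ hϑ0, mul_comm, Real.le_log_iff_exp_le (by linarith)]
    exact hx
  -- uniform reachability of `ball 0 ε₁` from `{H ≤ E}`, amplitudes at most `cmax`
  set cmax : ℝ := |Real.sqrt (2 * γ * Tmax)| + |Real.sqrt (2 * γ * Tmax)| with hcmax
  obtain ⟨s₁, hs₁⟩ := pinnedChain_reach_uniform hω hl hβ.le hγ hN E hε₁ (cmax := cmax) (by positivity)
  set n₀ : ℕ := ⌈s₁⌉₊ with hn₀
  obtain ⟨p, hp, hreach⟩ := hs₁ (n₀ : ℝ≥0) (Nat.le_ceil s₁)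
  set n : ℕ := n₀ + 1 with hn
  have hn0 : n ≠ 0 := Nat.succ_ne_zero _
  have hncast : ((n : ℕ) : ℝ≥0) = (n₀ : ℝ≥0) + 1 := by rw [hn, Nat.cast_succ]
  -- the minorising measure `ν₀ = cmin • Leb|_{B(0,r)}` and its normalisation
  haveI hpiP : (volume : Measure (Fin N → ℝ)).IsAddHaarMeasure := isAddHaarMeasure_volume_pi _
  haveI hvolP : (volume : Measure (PhaseSpace N)).IsAddHaarMeasure :=
    Measure.prod.instIsAddHaarMeasure (volume : Measure (Fin N → ℝ)) (volume : Measure (Fin N → ℝ))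
  have hball0 : volume (ball (0 : PhaseSpace N) r) ≠ 0 := (measure_ball_pos volume 0 hr).ne'
  have hballtop : volume (ball (0 : PhaseSpace N) r) ≠ ∞ := measure_ball_lt_top.ne
  set ν₀ : Measure (PhaseSpace N) := cmin • volume.restrict (ball (0 : PhaseSpace N) r) with hν₀
  set νP : Measure (PhaseSpace N) := (volume (ball (0 : PhaseSpace N) r))⁻¹ • volume.restrict (ball (0 : PhaseSpace N) r)
    with hνP
  haveI hνPprob : IsProbabilityMeasure νP := by
    refine ⟨?_⟩
    rw [hνP, Measure.smul_apply, Measure.restrict_apply_univ, smul_eq_mul, ENNReal.inv_mul_cancel hball0 hballtop]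
  -- `cmin · vol(B(0,r)) ≤ 1` and `p ≤ 1`: finiteness of the minorisation constant
  have hcminle : cmin * volume (ball (0 : PhaseSpace N) r) ≤ 1 := by
    have h0 : |Real.sqrt (2 * γ * T) / Real.sqrt (2 * γ * T) - 1| < ε₁ := by
      rw [div_self (Real.sqrt_pos.2 (by positivity)).ne', sub_self, abs_zero]; exact hε₁
    have h := hmin1 T T h0 h0 0 (by simpa using hε₁) (ball 0 r) Subset.rfl measurableSet_ball
    haveI : IsMarkovKernel (Pc.transitionKernel N T T 1) := pinnedChain_isMarkovKernel_transitionKernel hω hl hβ.le hγ.le N _ _ 1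
    exact h.trans prob_le_one
  set αE : ℝ≥0∞ := p * (cmin * volume (ball (0 : PhaseSpace N) r)) with hαE
  have hp1 : p ≤ 1 := by
    have h00 : |(0 : ℝ)| < δ₀ := by simpa using hδ₀pos
    have hamp : |Real.sqrt (2 * γ * (T + 0 / 2))| + |Real.sqrt (2 * γ * (T - 0 / 2))| ≤ cmax := by
      obtain ⟨-, -, hLm, hRm, -⟩ := hbath 0 h00
      rw [hcmax]; exact add_le_add (abs_sqrt_amp_le hγ hLm) (abs_sqrt_amp_le hγ hRm)
    have hz0 : Hm 0 ≤ E := by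
      refine hVE 0 ?_
      rw [show Hm 0 = 0 from pinnedChain_hamiltonian_origin ω₂ lam β γ N, mul_zero, Real.exp_zero]
      exact hR1
    haveI := pinnedChain_isMarkovKernel_transitionKernel hω hl hβ.le hγ.le N (T + 0 / 2) (T - 0 / 2) (n₀ : ℝ≥0)
    exact (hreach _ _ hamp 0 hz0).trans prob_le_one
  have hαE1 : αE ≤ 1 := by
    calc αE ≤ 1 * 1 := mul_le_mul' hp1 hcminle
      _ = 1 := one_mul _
  have hαEtop : αE ≠ ∞ := ne_top_of_le_ne_top ENNReal.one_ne_top hαE1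
  have hαE0 : αE ≠ 0 := mul_ne_zero hp.ne' (mul_ne_zero hcmin.ne' hball0)
  set α : ℝ≥0 := αE.toNNReal with hαdef
  have hαcoe : (α : ℝ≥0∞) = αE := ENNReal.coe_toNNReal hαEtop
  have hα0 : 0 < α := by
    rw [← ENNReal.coe_pos, hαcoe]; exact pos_iff_ne_zero.2 hαE0
  -- UMINOR at time `n = n₀ + 1`
  have hminor : ∀ δ : ℝ, |δ| < δ₀ → ∃ ν : Measure (PhaseSpace N), IsProbabilityMeasure ν ∧
      ∀ x : PhaseSpace N, Real.exp (ϑ * Hm x) ≤ R → α • ν ≤ κ δ (n : ℝ≥0) x := by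
    intro δ hδ
    obtain ⟨hL, hR, hLm, hRm, hratL, hratR⟩ := hbath δ hδ
    refine ⟨νP, hνPprob, fun x hx => ?_⟩
    -- reach the ball by time `n₀`
    have hamp : |Real.sqrt (2 * γ * (T + δ / 2))| + |Real.sqrt (2 * γ * (T - δ / 2))| ≤ cmax := by
      rw [hcmax]; exact add_le_add (abs_sqrt_amp_le hγ hLm) (abs_sqrt_amp_le hγ hRm)
    have hpx : p ≤ κ δ (n₀ : ℝ≥0) x (ball 0 ε₁) := hreach _ _ hamp x (hVE x hx)
    -- the local minorisation at time one, from the ball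
    have hν₀le : ∀ w ∈ ball (0 : PhaseSpace N) ε₁, ν₀ ≤ κ δ 1 w := by
      intro w hw
      refine Measure.le_iff.2 fun A hA => ?_
      rw [hν₀, Measure.smul_apply, Measure.restrict_apply hA, smul_eq_mul]
      exact (hmin1 _ _ hratL hratR w (mem_ball_zero_iff.1 hw) (A ∩ ball 0 r) inter_subset_right
        (hA.inter measurableSet_ball)).trans (measure_mono inter_subset_left)
    -- Chapman–Kolmogorov
    have hcomp : (κ δ (n₀ : ℝ≥0) x (ball 0 ε₁)) • ν₀ ≤ κ δ ((n₀ : ℝ≥0) + 1) x :=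
      MarkovSemigroup.smul_le_comp (κ δ) (h_add δ) (n₀ : ℝ≥0) 1 x (ball 0 ε₁) hν₀le
    rw [hncast]
    refine le_trans ?_ hcomp
    refine Measure.le_iff'.2 fun A => ?_
    have eL : (α • νP) A = p * (cmin * volume (ball (0 : PhaseSpace N) r)) *
        ((volume (ball (0 : PhaseSpace N) r))⁻¹ * volume.restrict (ball (0 : PhaseSpace N) r) A) := by
      rw [Measure.smul_apply, ENNReal.smul_def, smul_eq_mul, hαcoe, hαE, hνP, Measure.smul_apply, smul_eq_mul]
    have eR : ((κ δ (n₀ : ℝ≥0) x (ball 0 ε₁)) • ν₀) A =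
        κ δ (n₀ : ℝ≥0) x (ball 0 ε₁) * (cmin * volume.restrict (ball (0 : PhaseSpace N) r) A) := by
      rw [Measure.smul_apply, smul_eq_mul, hν₀, Measure.smul_apply, smul_eq_mul]
    rw [eL, eR]
    calc p * (cmin * volume (ball (0 : PhaseSpace N) r)) *
          ((volume (ball (0 : PhaseSpace N) r))⁻¹ * volume.restrict (ball 0 r) A)
        = p * (cmin * volume.restrict (ball 0 r) A) *
            (volume (ball (0 : PhaseSpace N) r) * (volume (ball (0 : PhaseSpace N) r))⁻¹) := by ring
      _ = p * (cmin * volume.restrict (ball 0 r) A) := by rw [ENNReal.mul_inv_cancel hball0 hballtop, mul_one]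
      _ ≤ κ δ (n₀ : ℝ≥0) x (ball 0 ε₁) * (cmin * volume.restrict (ball 0 r) A) := mul_le_mul' hpx le_rfl
  -- the conditions of the uniform Harris theorem
  have hγ' : a ^ n < 1 := pow_lt_one₀ zero_le ha1 hn0
  have hRcond : 2 * B < (1 - a ^ n) * R := by
    have ham : a ^ n ≤ a := pow_le_of_le_one zero_le ha1.le hn0
    calc 2 * B < 2 * B + 1 := lt_add_one _
      _ = (1 - a) * R := hRa.symm
      _ ≤ (1 - a ^ n) * R := mul_le_mul_of_nonneg_right (tsub_le_tsub_left ham 1) zero_le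
  have ht₀ : (0 : ℝ≥0) < (n : ℝ≥0) := by exact_mod_cast Nat.pos_of_ne_zero hn0
  have hdrift' : ∀ δ : ℝ, |δ| < δ₀ → ∀ z : PhaseSpace N,
      ∫⁻ y, ENNReal.ofReal (Real.exp (ϑ * Pc.hamiltonian N y)) ∂(Pc.transitionKernel N (T + δ / 2) (T - δ / 2) n z) ≤
        ((a ^ n : ℝ≥0) : ℝ≥0∞) * ENNReal.ofReal (Real.exp (ϑ * Pc.hamiltonian N z)) + B := by
    intro δ hδ z
    have h := hdriftn δ hδ n z
    simpa only [hVcoe] using h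
  have hϑT' : ϑ < 1 / (T + δ₀ / 2) := hϑT
  obtain ⟨Cm, c, hCm, hc, hUM⟩ := pinnedChain_uniformMixing_of_uniformDriftMinor hω hl hβ.le hγ hN hT hδ₀2T hϑ0 hϑT'
    ht₀ hγ' hα0 hRcond hdrift' hminor
  exact ⟨δ₀, ϑ, Cm, c, hδ₀pos, hδ₀2T, hϑ0, hϑT', h2ϑ, hCm, hc, hUM⟩

end UM

/-- **(UH) — the uniform relaxation of the forecast of the total current**, the hypothesis of
`OpenChainGreenKubo.openChainGreenKubo_of_uniformDecay`: for all parameters `> 0`, `T > 0`, `N ≥ 2`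
there are `δ₀, ϑ, C, c > 0` (`ϑ < 1/T`) such that for every `|δ| ≤ δ₀`,
`|P^δ_t J(z) - m_δ| ≤ C e^{ϑH(z)} e^{-ct}` with `m_δ` the mean of `J` in the (CEHR) invariant
probability measure of the kernels with baths at `T ± δ/2`.
[cite: CuneoEckmannHairerReyBellet2018, Thm 2.13 eq. (2.5)] -/
theorem uniformDecay_totalCurrent :
    ∀ ω₂ lam β γ : ℝ, 0 < ω₂ → 0 < lam → 0 < β → 0 < γ →
      ∀ T : ℝ, 0 < T → ∀ N : ℕ, 2 ≤ N →
        ∃ δ₀ ϑ C c : ℝ, 0 < δ₀ ∧ 0 < ϑ ∧ ϑ < 1 / T ∧ 0 < c ∧ ∀ δ : ℝ, |δ| ≤ δ₀ → ∃ m : ℝ,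
          ∀ (z : PhaseSpace N) (t : ℝ≥0),
            |(∫ y, (∑ i : Fin N, (pinnedChain ω₂ lam β γ).bondCurrent N i y)
                ∂((pinnedChain ω₂ lam β γ).transitionKernel N (T + δ / 2) (T - δ / 2) t z)) - m| ≤
              C * Real.exp (ϑ * (pinnedChain ω₂ lam β γ).hamiltonian N z) * Real.exp (-c * t) := by
  intro ω₂ lam β γ hω hl hβ hγ T hT N hN
  have hN0 : 0 < N := by omega
  obtain ⟨δ₀, ϑ, Cm, c, hδ₀, hδ₀T, hϑ0, hϑT, h2ϑ, hCm, hc, hUM⟩ :=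
    pinnedChain_uniformMixing (N := N) hω hl.le hβ hγ hN0 hT
  have hϑT1 : ϑ < 1 / T := hϑT.trans_le (one_div_le_one_div_of_le hT (by linarith))
  obtain ⟨M, hM0, hM⟩ := abs_totalBondCurrent_le_exp hω.le hl.le hβ.le γ N hϑ0
  set M₁ : ℝ := M + 1 with hM₁
  have hM₁ : 0 < M₁ := by positivity
  refine ⟨δ₀ / 2, ϑ, M₁ * Cm, c, by positivity, hϑ0, hϑT1, hc, fun δ hδ => ?_⟩
  have hδ' : |δ| < δ₀ := by linarith
  have h1 := abs_lt.1 hδ'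
  have hL : 0 < T + δ / 2 := by linarith
  have hR : 0 < T - δ / 2 := by linarith
  -- an invariant probability measure of the kernels at `(T + δ/2, T - δ/2)`
  obtain ⟨-, μs, hμs, hinv, -⟩ := pinnedChainSemigroup_ergodic hω hl.le hβ hγ hN0 hL hR
  haveI := hμs
  let J : PhaseSpace N → ℝ := fun y => ∑ i : Fin N, (pinnedChain ω₂ lam β γ).bondCurrent N i y
  let f : PhaseSpace N → ℝ := fun y => M₁⁻¹ * J y
  have hJf : ∀ y, J y = M₁ * f y := fun y => by
    show J y = M₁ * (M₁⁻¹ * J y)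
    rw [← mul_assoc, mul_inv_cancel₀ hM₁.ne', one_mul]
  have hfc : Continuous f := continuous_const.mul (continuous_totalBondCurrent ω₂ lam β γ N)
  have hfb : ∀ y, |f y| ≤ Real.exp (ϑ * (pinnedChain ω₂ lam β γ).hamiltonian N y) := by
    intro y
    show |M₁⁻¹ * J y| ≤ _
    rw [abs_mul, abs_of_pos (inv_pos.2 hM₁)]
    calc M₁⁻¹ * |J y| ≤ M₁⁻¹ * (M * Real.exp (ϑ * (pinnedChain ω₂ lam β γ).hamiltonian N y)) :=
          mul_le_mul_of_nonneg_left (hM y) (inv_pos.2 hM₁).le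
      _ = (M₁⁻¹ * M) * Real.exp (ϑ * (pinnedChain ω₂ lam β γ).hamiltonian N y) := by ring
      _ ≤ 1 * Real.exp (ϑ * (pinnedChain ω₂ lam β γ).hamiltonian N y) := by
          refine mul_le_mul_of_nonneg_right ?_ (Real.exp_pos _).le
          rw [inv_mul_le_iff₀ hM₁]; linarith
      _ = _ := one_mul _
  have hinv' : ∀ t : ℝ≥0, μs.bind ((pinnedChain ω₂ lam β γ).transitionKernel N (T + δ / 2) (T - δ / 2) t) = μs :=
    fun t => hinv t
  refine ⟨∫ y, J y ∂μs, fun z t => ?_⟩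
  have h := hUM δ hδ' μs hμs hinv' z t f hfc hfb
  have e1 : (∫ y, J y ∂((pinnedChain ω₂ lam β γ).transitionKernel N (T + δ / 2) (T - δ / 2) t z)) =
      M₁ * ∫ y, f y ∂((pinnedChain ω₂ lam β γ).transitionKernel N (T + δ / 2) (T - δ / 2) t z) := by
    rw [← integral_const_mul]; exact integral_congr_ae (Eventually.of_forall hJf)
  have e2 : (∫ y, J y ∂μs) = M₁ * ∫ y, f y ∂μs := by
    rw [← integral_const_mul]; exact integral_congr_ae (Eventually.of_forall hJf)
  show |(∫ y, J y ∂((pinnedChain ω₂ lam β γ).transitionKernel N (T + δ / 2) (T - δ / 2) t z)) - ∫ y, J y ∂μs| ≤ _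
  rw [e1, e2, ← mul_sub, abs_mul, abs_of_pos hM₁, mul_assoc, mul_assoc]
  exact mul_le_mul_of_nonneg_left (by rw [← mul_assoc]; exact h) hM₁.le

/-- **`HonestZwanzig.OpenChainGreenKubo` (item stmt-AtomisticToContinuum-12696) HOLDS**: the
Kundu–Dhar–Narayan open-chain Green–Kubo identity for the pinned chain, from
`openChainGreenKubo_of_uniformDecay` (★, the KDN identity and the uniform-decay reduction, all in the tree)
and `uniformDecay_totalCurrent`. [cite: KunduDharNarayan2009, p. 3] -/
theorem openChainGreenKubo_holds : Summit.AtomisticToContinuum.FouriersLaw.Theses.HonestZwanzig.OpenChainGreenKubo :=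
  OpenChainGreenKubo.openChainGreenKubo_of_uniformDecay uniformDecay_totalCurrent

/-- **`OddSectorIrreversibility.ResponseDensity` (item stmt-AtomisticToContinuum-9144) HOLDS**, from
`responseDensity_of_uniformMixing` (prover 9144-0's reduction) and `pinnedChain_uniformMixing`.
[cite: HairerMajda2009, Thm 2.3] -/
theorem responseDensity_holds : Summit.AtomisticToContinuum.FouriersLaw.Theses.OddSectorIrreversibility.ResponseDensity :=
  responseDensity_of_uniformMixing fun _ _ _ _ hω hl hβ hγ _ hT _ hN =>
    pinnedChain_uniformMixing hω hl.le hβ hγ hN hT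

/-- **`CorrectorTheory` (item stmt-AtomisticToContinuum-14071), PROVED**: conjunct A is
`correctorCalculus`; conjunct B is the open-chain Green–Kubo identity, supplied by
`openChainGreenKubo_holds` through `CorrectorTheory_of_openChainGreenKubo`.
[cite: KunduDharNarayan2009, p. 3] [cite: CuneoEckmannHairerReyBellet2018, Thm 2.13] -/
theorem CorrectorTheory_proof : Summit.AtomisticToContinuum.FouriersLaw.Theses.OddSectorIrreversibility.CorrectorTheory :=
  CorrectorTheory_of_openChainGreenKubo openChainGreenKubo_holds

end Summit.AtomisticToContinuum.FouriersLaw.Theorems.OddSectorIrreversibility.Corrector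

end
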